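import Mathlib
import Summits.ResolutionOfSingularities.ResolutionOfSingularities.Theorems.WeightedInvariantLocalWeightedDropPolyDescentTailTools

/-!
# `WeightedInvariant.LocalWeightedDrop`, stub S3ρ: the monic polyhedron descent — A RE-CENTRING BETWEEN TWO POSITIONS HAS ORDER `≥ 2`, so its
# `u₁`-chart transform has no constant term (tool for the bridge (ρ-B), case (b), and for (ρ-T))

Crux item stmt-ResolutionOfSingularities-8899 `LocalWeightedDrop` (route `ResolutionOfSingularities/WeightedInvariant`), registered skeleton v30
(09f812eb3be8b7d8), stub S3ρ `stub_wildMonicSurfaceReductionWon`.  [OURS · L1 W4.3, chain w43, lead prover (gen 3); a LINE UNDER THE STUB: the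
monic polyhedron descent (line file `poly_descent_line_v1.lean` evidence on stmt-8899); elementary bookkeeping, nothing here is a statement of any
manuscript.]

* `coeff_eq_zero_of_isPosT_mul_pow` — for a position `S` and `ψ(0) = 0`, `S_j ψ^j` has no monomial of degree `≤ d`;
* `two_le_order_of_isPosT_shift` — if `S` and `shift S ψ` are positions (`0 < d`, `ψ(0) = 0`) then `ord ψ ≥ 2`: slot `0` of the shift is
  `ψ^d + Σ_j S_j ψ^j` of order `> d`, so `d · ord ψ = ord ψ^d > d` (`FormalShear.order_pow_eq`);
* `constantCoeff_blowOne`, `constantCoeff_blowOne_one_eq_zero` — `(blowOne c ψ)(0) = [u₁^c]ψ`, hence `(blowOne 1 ψ)(0) = 0` when `ord ψ ≥ 2`: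
  the `u₁`-chart of a prepared label `blowOneT (prep S) = shift (blowOneT S) (blowOne 1 ψ)` (`blowOneT_shift`) is a re-centring WITHOUT constant
  term of the `u₁`-chart of `S`, so `WildMonic.won_monic_recentre_iff` applies (`constantCoeff_blowOne_prepRecentring`).
-/

set_option linter.dupNamespace false -- mandated namespace of this single-conjunct summit

noncomputable section

namespace Summit.ResolutionOfSingularities.ResolutionOfSingularities.Theorems

namespace PolyDescent

open MvPowerSeries MonicDescent WildMonic Literature.RingTheory.TwoVariableSeries Literature.AlgebraicGeometry.Resolution

variable {k : Type} [Field k]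

/-- For a position `S` and `ψ` without constant term, `S_j · ψ^j` has no monomial of degree `≤ d`. -/
theorem coeff_eq_zero_of_isPosT_mul_pow {d : ℕ} {S : Fin d → MvPowerSeries (Fin 2) k} (hS : IsPosT d S) {ψ : MvPowerSeries (Fin 2) k}
    (hψ : constantCoeff ψ = 0) (j : Fin d) {e : Fin 2 →₀ ℕ} (he : Finsupp.degree e ≤ d) : coeff e (S j * ψ ^ (j : ℕ)) = 0 := by
  have h1 : (1 : ℕ∞) ≤ ψ.order := one_le_order_iff_constCoeff_eq_zero.mpr hψ
  apply coeff_of_lt_order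
  refine lt_of_lt_of_le ?_ le_order_mul
  have hj : ((j : ℕ) : ℕ∞) ≤ (ψ ^ (j : ℕ)).order := by
    refine le_trans ?_ (le_order_pow (j : ℕ))
    have h := nsmul_le_nsmul_right h1 (j : ℕ)
    rwa [nsmul_one] at h
  have hSj : ((d - (j : ℕ) : ℕ) : ℕ∞) < (S j).order := hS j
  have hdeg : ((Finsupp.degree e : ℕ) : ℕ∞) ≤ ((d - (j : ℕ) : ℕ) : ℕ∞) + ((j : ℕ) : ℕ∞) := by
    rw [← Nat.cast_add]; exact_mod_cast (by have := j.2; omega : Finsupp.degree e ≤ d - (j : ℕ) + (j : ℕ))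
  refine lt_of_le_of_lt hdeg ?_
  calc ((d - (j : ℕ) : ℕ) : ℕ∞) + ((j : ℕ) : ℕ∞) < (S j).order + ((j : ℕ) : ℕ∞) :=
        (WithTop.add_lt_add_iff_right (WithTop.coe_ne_top (a := (j : ℕ)))).mpr hSj
    _ ≤ (S j).order + (ψ ^ (j : ℕ)).order := add_le_add_right hj _

/-- IF `S` AND `shift S ψ` ARE BOTH POSITIONS (`0 < d`, `ψ(0) = 0`) THEN `ord ψ ≥ 2`: slot `0` of the shift, `ψ^d + Σ_j S_j ψ^j`, has order `> d`,
and so has `Σ_j S_j ψ^j`; hence `ord ψ^d = d · ord ψ > d`. -/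
theorem two_le_order_of_isPosT_shift {d : ℕ} (hd : 0 < d) {S : Fin d → MvPowerSeries (Fin 2) k} {ψ : MvPowerSeries (Fin 2) k}
    (hS : IsPosT d S) (hS' : IsPosT d (shift d S ψ)) (hψ : constantCoeff ψ = 0) : (2 : ℕ∞) ≤ ψ.order := by
  have h1 : (1 : ℕ∞) ≤ ψ.order := one_le_order_iff_constCoeff_eq_zero.mpr hψ
  have heq : ψ ^ d = shift d S ψ ⟨0, hd⟩ - ∑ j : Fin d, S j * ψ ^ (j : ℕ) := by rw [shift_apply_zero hd]; ring
  -- every monomial of degree ≤ d of ψ^d vanishes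
  have hpow : (((d + 1 : ℕ)) : ℕ∞) ≤ (ψ ^ d).order := by
    apply nat_le_order
    intro e he
    have hed : Finsupp.degree e ≤ d := by omega
    rw [heq, map_sub, map_sum, Finset.sum_eq_zero fun j _ => coeff_eq_zero_of_isPosT_mul_pow hS hψ j hed, sub_zero]
    exact coeff_of_lt_order (lt_of_le_of_lt (by simp only [Nat.sub_zero, Nat.cast_le]; exact hed) (hS' ⟨0, hd⟩))
  rw [FormalShear.order_pow_eq] at hpow
  by_contra hlt
  push Not at hlt
  have hle1 : ψ.order ≤ 1 := Order.le_of_lt_add_one (by simpa [one_add_one_eq_two] using hlt)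
  have heq1 : ψ.order = 1 := le_antisymm hle1 h1
  rw [heq1, mul_one] at hpow
  have := (Nat.cast_le (α := ℕ∞)).mp hpow
  omega

/-- The constant term of the `u₁`-chart transform `blowOne c ψ = ψ(u₁, u₁u₂)/u₁^c` is the coefficient of `u₁^c` in `ψ`. -/
theorem constantCoeff_blowOne (c : ℕ) (ψ : MvPowerSeries (Fin 2) k) : constantCoeff (blowOne c ψ) = coeff (Finsupp.single 0 c) ψ := by
  rw [← coeff_zero_eq_constantCoeff_apply, coeff_blowOne]
  simp

/-- If `ord ψ ≥ 2` then `blowOne 1 ψ` has no constant term. -/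
theorem constantCoeff_blowOne_one_eq_zero {ψ : MvPowerSeries (Fin 2) k} (h : (2 : ℕ∞) ≤ ψ.order) : constantCoeff (blowOne 1 ψ) = 0 := by
  rw [constantCoeff_blowOne]
  exact coeff_of_lt_order (lt_of_lt_of_le (by rw [Finsupp.degree_single]; exact_mod_cast Nat.lt_succ_self 1) h)

/-- THE CHART-LEVEL RE-CENTRING OF A PREPARED LABEL HAS NO CONSTANT TERM: if `S` and `shift S ψ` are positions (`0 < d`, `ψ(0) = 0`) then
`(blowOne 1 ψ)(0) = 0` — so `blowOneT (shift S ψ) = shift (blowOneT S) (blowOne 1 ψ)` (`blowOneT_shift`) is a legal free re-centring for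
`WildMonic.won_monic_recentre_iff`. -/
theorem constantCoeff_blowOne_prepRecentring {d : ℕ} (hd : 0 < d) {S : Fin d → MvPowerSeries (Fin 2) k} {ψ : MvPowerSeries (Fin 2) k}
    (hS : IsPosT d S) (hS' : IsPosT d (shift d S ψ)) (hψ : constantCoeff ψ = 0) : constantCoeff (blowOne 1 ψ) = 0 :=
  constantCoeff_blowOne_one_eq_zero (two_le_order_of_isPosT_shift hd hS hS' hψ)

end PolyDescent

end Summit.ResolutionOfSingularities.ResolutionOfSingularities.Theorems

end
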